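import Literature.Computability.AlgebraicComplexity.BDI20NisanWidthProofs
import Literature.Computability.AlgebraicComplexity.DeterminantBorderWaringRank
import Literature.Computability.AlgebraicComplexity.TableauPolarization
import Literature.LinearAlgebra.Matrix.RankMinors
import HarnessLib

/-!
# Bläser–Dörfler–Ikenmeyer 2020, Theorem 4.2: `w(f) ≤ ncw(f) ≤ W̄R(f)` — PROOF of the typed fact
# `BDI2020_thm_4_2_chain` (hence of `BDI2020_thm_4_2` and `BDI2020_thm_4_1`, "`VW̄aring ⊆ VBP`")

Topic: `Literature/Computability/AlgebraicComplexity`. Source: M. Bläser, J. Dörfler, C. Ikenmeyer,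
*On the complexity of evaluating highest weight vectors*, CCC 2021 (LIPIcs 200) 29 =
arXiv:2002.11594 [BlaserDorflerIkenmeyer2020], Thm. 4.2 and its proof (§4, p.29:6–7; §6). Theorem-only
file: it discharges `BDI2020_thm_4_2_chain` of the statement file `BDI20WaringRankABPWidth.lean`
(typer x6), whose proved glue `BDI2020_thm_4_2_of_chain` / `BDI2020_thm_4_1_of_thm_4_2` then make
Thm. 4.2 (`w(f) ≤ W̄R(f)`) and Thm. 4.1 (`VW̄aring ⊆ VBP`) theorems as well.

## The printed proof and its rendering

"In fact, we prove `w(f) ≤ ncw(f) ≤ W̄R(f)`" (p.29:6).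

* `w(f) ≤ ncw(f)`: "Every ncABP can be reinterpreted as a cABP by letting the variables commute …
  an ncABP computing the symmetric tensor of `f` computes `f`" — the symmetric tensor of `f` IS a word
  lift of `f` (`BDI2020.isWordLift_symTensor`: by linearity from the powers of linear forms, which
  span the forms in characteristic `0` (`mem_span_linearPowers_of_isHomogeneous`), where the
  symmetric tensor of `ℓ^d` is the rank-one word tensor `a ⊗ ⋯ ⊗ a` by the polarisation identity
  `TableauEval.permanent_lookup_eq_ffact_mul_coeff`); the width sets are non-empty by Nisan's theorem
  (`BDI2020.hasNcABPWidthLE_iff_wordTTRank_le`). `BDI2020.abpWidth_le_ncAbpWidthPoly`.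
* `ncw(f) ≤ W̄R(f)`: "a border Waring rank decomposition … gives a border ncABP with `s` disjoint
  paths … Nisan's rank characterisation shows border ncABP width = ncABP width" — rendered through
  the flattenings: for `f = Σ_{i<r} ℓ_i^d` every flattening of the symmetric tensor is a sum of `r`
  rank-one matrices (`BDI2020.rank_wordFlattening_symTensor_le_of_mem_waringSums`); the rank
  condition (vanishing of the `(r+1)`-minors, polynomials in the coefficients of `f`,
  `Literature.LinearAlgebra.Matrix.rank_le_iff_det_submatrix_eq_zero`) persists on the Zariski
  closure `σ_r` (`BDI2020.rank_wordFlattening_symTensor_le_of_isBorderWaringRankLE`, the tree's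
  `IsBorderWaringRankLE`), and Nisan's theorem (⇐) turns the rank bound into an ncABP of width
  `≤ r` (`BDI2020.ncAbpWidthPoly_le_borderPolyWaringRank`; the border rank of a form of degree
  `d ≥ 1` over `ℂ` exists by `exists_isBorderWaringRankLE_of_isHomogeneous`).

Honest framing (val-lit): a discharge of a published, proved statement; nothing here bears on
`VP ≠ VNP`.

## References

* [BlaserDorflerIkenmeyer2020] CCC 2021 Thm. 4.2 = arXiv:2002.11594 Thm. 2 (p0006:L67–71,
  p0007:L22–29); Prop. 6.6 (Nisan's characterisation, file `BDI20NisanWidthProofs.lean`).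
* [Nisan1991] N. Nisan, STOC 1991, Thm. 1.
-/

noncomputable section

open Matrix Module MvPolynomial
open scoped BigOperators

namespace Literature.Computability.AlgebraicComplexity

namespace BDI2020

/-! ### The symmetric tensor is linear in the form and lifts it -/

section SymTensor

variable {F : Type*} [Field F] {m : ℕ}

/-- The symmetric tensor as a linear map in the form. [cite: BlaserDorflerIkenmeyer2020, §4 (CCC 2021 p.29:7)] -/
def symTensorₗ (d : ℕ) : MvPolynomial (Fin m) F →ₗ[F] ((Fin d → Fin m) → F) where
  toFun := symTensor d
  map_add' f g := by
    funext w
    simp [symTensor, add_mul]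
  map_smul' c f := by
    funext w
    simp [symTensor, mul_assoc]

/-- Unfolding lemma. [cite: BlaserDorflerIkenmeyer2020, §4 (CCC 2021 p.29:7)] -/
@[simp] theorem symTensorₗ_apply (d : ℕ) (f : MvPolynomial (Fin m) F) :
    symTensorₗ d f = symTensor d f := rfl

/-- Word lifts add. [cite: Nisan1991, §2] -/
theorem isWordLift_add {d : ℕ} {Ψ₁ Ψ₂ : (Fin d → Fin m) → F} {f₁ f₂ : MvPolynomial (Fin m) F}
    (h₁ : IsWordLift Ψ₁ f₁) (h₂ : IsWordLift Ψ₂ f₂) : IsWordLift (Ψ₁ + Ψ₂) (f₁ + f₂) := by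
  rw [isWordLift_iff] at h₁ h₂ ⊢
  rw [← h₁, ← h₂, ← Finset.sum_add_distrib]
  exact Finset.sum_congr rfl fun w _ => by rw [Pi.add_apply, add_smul]

/-- Word lifts scale. [cite: Nisan1991, §2] -/
theorem isWordLift_smul {d : ℕ} {Ψ : (Fin d → Fin m) → F} {f : MvPolynomial (Fin m) F}
    (h : IsWordLift Ψ f) (c : F) : IsWordLift (c • Ψ) (c • f) := by
  rw [isWordLift_iff] at h ⊢
  rw [← h, Finset.smul_sum]
  exact Finset.sum_congr rfl fun w _ => by rw [Pi.smul_apply, smul_eq_mul, mul_smul]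

/-- The zero tensor lifts `0`. [cite: Nisan1991, §2] -/
theorem isWordLift_zero (d : ℕ) : IsWordLift (0 : (Fin d → Fin m) → F) (0 : MvPolynomial (Fin m) F) := by
  rw [isWordLift_iff]
  simp

/-- The rank-one word tensor `a ⊗ ⋯ ⊗ a` lifts `ℓ_a^d` (expand the product of `d` copies of
`ℓ_a = Σ_v a_v x_v`). [cite: BlaserDorflerIkenmeyer2020, §4 (CCC 2021 p.29:7)] -/
theorem isWordLift_prodTensor (d : ℕ) (a : Fin m → F) :
    IsWordLift (fun w : Fin d → Fin m => ∏ t, a (w t)) (linearForm a ^ d) := by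
  classical
  rw [isWordLift_iff, linearForm, Finset.sum_pow', Fintype.piFinset_univ]
  refine Finset.sum_congr rfl fun w _ => ?_
  rw [Finset.prod_mul_distrib, ← map_prod C, smul_eq_C_mul]

/-- **The symmetric tensor of `ℓ_a^d` is `a ⊗ ⋯ ⊗ a`** (polarisation identity: the permanent of the
constant-row matrix `(a_{w_{s'}})_{s,s'}` is `d! ∏_s a_{w_s}` and equals `α(w)! · coeff_{α(w)} ℓ^d`).
[cite: BlaserDorflerIkenmeyer2020, §4 (CCC 2021 p.29:7)] -/
theorem symTensor_linearForm_pow [CharZero F] (d : ℕ) (a : Fin m → F) (w : Fin d → Fin m) :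
    symTensor d (linearForm a ^ d) w = ∏ t, a (w t) := by
  classical
  have hpol := TableauEval.permanent_lookup_eq_ffact_mul_coeff (K := F) (fun _ : Fin d => a) w
  have hperm : (Matrix.of fun (s s' : Fin d) => a (w s')).permanent = (d.factorial : F) * ∏ t, a (w t) := by
    simp [Matrix.permanent, Finset.sum_const, Finset.card_univ, Fintype.card_perm]
  have hprod : (∏ _s : Fin d, TableauEval.linForm (K := F) a) = linearForm a ^ d := by
    rw [Fin.prod_const]; rfl
  rw [hperm, hprod] at hpol
  have hd : (d.factorial : F) ≠ 0 := Nat.cast_ne_zero.2 (Nat.factorial_ne_zero d)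
  rw [symTensor, mul_div_assoc', div_eq_iff hd, mul_comm (coeff _ _), ← hpol, mul_comm]

/-- **The symmetric tensor of a form lifts it**: for `f` homogeneous of degree `d` in characteristic
`0`, `Σ_i symTensor(f)(i) · x_{i_1} ⋯ x_{i_d} = f` ("an ncABP computing the symmetric tensor of `f`,
read with commuting variables, computes `f`"). By linearity from the powers of linear forms, which
span the forms. [cite: BlaserDorflerIkenmeyer2020, §4 (CCC 2021 p.29:5–7)] -/
theorem isWordLift_symTensor [CharZero F] {d : ℕ} {f : MvPolynomial (Fin m) F}
    (hf : f.IsHomogeneous d) : IsWordLift (symTensor d f) f := by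
  have hmem := mem_span_linearPowers_of_isHomogeneous hf
  refine Submodule.span_induction (p := fun g _ => IsWordLift (symTensor d g) g) ?_ ?_ ?_ ?_ hmem
  · rintro g ⟨a, rfl⟩
    have : symTensor d (linearForm a ^ d) = fun w => ∏ t, a (w t) :=
      funext fun w => symTensor_linearForm_pow d a w
    rw [this]
    exact isWordLift_prodTensor d a
  · have : symTensor d (0 : MvPolynomial (Fin m) F) = 0 := (symTensorₗ (F := F) (m := m) d).map_zero
    rw [this]
    exact isWordLift_zero d
  · intro g g' _ _ hg hg'
    have : symTensor d (g + g') = symTensor d g + symTensor d g' := (symTensorₗ d).map_add g g'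
    rw [this]
    exact isWordLift_add hg hg'
  · intro c g _ hg
    have : symTensor d (c • g) = c • symTensor d g := (symTensorₗ d).map_smul c g
    rw [this]
    exact isWordLift_smul hg c

end SymTensor

/-! ### Flattenings of symmetric tensors of Waring sums and of their limits -/

section Flattening

variable {F : Type*} [Field F] {m : ℕ}

/-- The flattening is additive in the tensor. [cite: Nisan1991, §2] -/
theorem wordFlattening_sum {d : ℕ} {ι : Type*} (s : Finset ι) (Ψ : ι → (Fin d → Fin m) → F)
    (a b : ℕ) (h : a + b = d) :
    wordFlattening (∑ i ∈ s, Ψ i) a b h = ∑ i ∈ s, wordFlattening (Ψ i) a b h := by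
  ext p q
  simp [wordFlattening_apply, Finset.sum_apply, Matrix.sum_apply]

/-- The flattening of the rank-one word tensor `a ⊗ ⋯ ⊗ a` is the rank-one matrix
`(∏_t a_{p_t}) (∏_t a_{q_t})`. [cite: BlaserDorflerIkenmeyer2020, Prop 12 (arXiv; = CCC 2021 Prop 6.6), proof] -/
theorem wordFlattening_prodTensor {d : ℕ} (c : Fin m → F) (a b : ℕ) (h : a + b = d) :
    wordFlattening (fun w : Fin d → Fin m => ∏ t, c (w t)) a b h =
      Matrix.vecMulVec (fun p : Fin a → Fin m => ∏ t, c (p t)) (fun q : Fin b → Fin m => ∏ t, c (q t)) := by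
  subst h
  ext p q
  rw [wordFlattening_apply, Matrix.vecMulVec_apply]
  have hcast : (∏ t : Fin (a + b), c (Fin.append p q (Fin.cast (rfl : a + b = a + b).symm t))) =
      ∏ t : Fin (a + b), c (Fin.append p q t) := rfl
  rw [hcast, Fin.prod_univ_add]
  simp only [Fin.append_left, Fin.append_right]

/-- Subadditivity of the matrix rank. [folklore] -/
private theorem rank_add_le' {μ ν : Type*} [Fintype μ] [Fintype ν] (M₁ M₂ : Matrix μ ν F) :
    (M₁ + M₂).rank ≤ M₁.rank + M₂.rank := by
  classical
  unfold Matrix.rank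
  rw [Matrix.mulVecLin_add]
  calc finrank F (LinearMap.range (M₁.mulVecLin + M₂.mulVecLin))
      ≤ finrank F (LinearMap.range M₁.mulVecLin ⊔ LinearMap.range M₂.mulVecLin :
          Submodule F (μ → F)) := by
        apply Submodule.finrank_mono
        rintro v ⟨x, rfl⟩
        exact Submodule.add_mem_sup ⟨x, rfl⟩ ⟨x, rfl⟩
    _ ≤ _ := Submodule.finrank_add_le_finrank_add_finrank _ _

/-- Rank of a finite sum is at most the sum of the ranks. [folklore] -/
private theorem rank_sum_le' {μ ν ι : Type*} [Fintype μ] [Fintype ν] (s : Finset ι)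
    (M : ι → Matrix μ ν F) : (∑ i ∈ s, M i).rank ≤ ∑ i ∈ s, (M i).rank := by
  classical
  refine Finset.induction_on s (by simp [Matrix.rank_zero]) ?_
  intro i s hi ih
  rw [Finset.sum_insert hi, Finset.sum_insert hi]
  exact (rank_add_le' _ _).trans (by omega)

/-- **Waring sums have flattening ranks `≤ r`**: for `f = ℓ_1^d + ⋯ + ℓ_r^d` every flattening of the
symmetric tensor of `f` is a sum of `r` rank-one matrices. [cite: BlaserDorflerIkenmeyer2020, Thm 2 (arXiv; = CCC 2021 Thm 4.2), proof] -/
theorem rank_wordFlattening_symTensor_le_of_mem_waringSums [CharZero F] {d r : ℕ}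
    {f : MvPolynomial (Fin m) F} (hf : f ∈ waringSums F m d r) (a b : ℕ) (h : a + b = d) :
    (wordFlattening (symTensor d f) a b h).rank ≤ r := by
  classical
  obtain ⟨c, rfl⟩ := hf
  have hsum : symTensor d (∑ i, linearForm (c i) ^ d) =
      ∑ i, fun w : Fin d → Fin m => ∏ t, c i (w t) := by
    rw [← symTensorₗ_apply, map_sum]
    refine Finset.sum_congr rfl fun i _ => ?_
    exact funext fun w => symTensor_linearForm_pow d (c i) w
  rw [hsum, wordFlattening_sum]
  refine (rank_sum_le' _ _).trans ?_
  calc ∑ i, (wordFlattening (fun w : Fin d → Fin m => ∏ t, c i (w t)) a b h).rank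
      ≤ ∑ _i : Fin r, 1 := Finset.sum_le_sum fun i _ => by
        rw [wordFlattening_prodTensor]
        exact Matrix.rank_vecMulVec_le _ _
    _ = r := by simp

/-- **Flattening-rank bounds persist on Zariski closures** (the `(r+1)`-minors of the flattening of
the symmetric tensor are polynomials in the coefficients of the form). [cite: BlaserDorflerIkenmeyer2020, Thm 2 (arXiv; = CCC 2021 Thm 4.2), proof] -/
theorem rank_wordFlattening_symTensor_le_of_mem_zariskiClosure {d r : ℕ}
    {S : Set (MvPolynomial (Fin m) F)} {g : MvPolynomial (Fin m) F}
    (hg : coeffVec g ∈ zariskiClosure (coeffVec '' S)) (a b : ℕ) (h : a + b = d)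
    (hS : ∀ f ∈ S, (wordFlattening (symTensor d f) a b h).rank ≤ r) :
    (wordFlattening (symTensor d g) a b h).rank ≤ r := by
  classical
  rw [Literature.LinearAlgebra.Matrix.rank_le_iff_det_submatrix_eq_zero]
  intro ρ γ
  -- the chosen minor, as a polynomial in the coefficient vector
  let α : Fin (r + 1) → Fin (r + 1) → (Fin m →₀ ℕ) := fun i j =>
    TableauEval.wordContent (fun t => Fin.append (ρ i) (γ j) (Fin.cast h.symm t))
  let P : Matrix (Fin (r + 1)) (Fin (r + 1)) (MvPolynomial (Fin m →₀ ℕ) F) :=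
    Matrix.of fun i j => X (α i j) * C ((TableauEval.ffact (α i j) : F) / (d.factorial : F))
  have hP : ∀ f : MvPolynomial (Fin m) F, aeval (coeffVec f) P.det =
      ((wordFlattening (symTensor d f) a b h).submatrix ρ γ).det := by
    intro f
    rw [AlgHom.map_det, AlgHom.mapMatrix_apply]
    congr 1
    ext i j
    simp [P, α, symTensor, coeffVec]
  have hvan := (mem_zariskiClosure_iff.1 hg) P.det (by
    rintro _ ⟨f, hf, rfl⟩
    rw [hP]
    exact (Literature.LinearAlgebra.Matrix.rank_le_iff_det_submatrix_eq_zero _).1 (hS f hf) ρ γ)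
  rwa [hP] at hvan

/-- **`R̲_S(f) ≤ r` ⟹ all flattening ranks of the symmetric tensor are `≤ r`** (characteristic `0`).
[cite: BlaserDorflerIkenmeyer2020, Thm 2 (arXiv; = CCC 2021 Thm 4.2), proof] -/
theorem rank_wordFlattening_symTensor_le_of_isBorderWaringRankLE [CharZero F] {d r : ℕ}
    {f : MvPolynomial (Fin m) F} (hf : IsBorderWaringRankLE d r f) (a b : ℕ) (h : a + b = d) :
    (wordFlattening (symTensor d f) a b h).rank ≤ r :=
  rank_wordFlattening_symTensor_le_of_mem_zariskiClosure hf a b h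
    fun _ hg => rank_wordFlattening_symTensor_le_of_mem_waringSums hg a b h

end Flattening

/-! ### Assembly over `ℂ` -/

section Assembly

variable {m : ℕ}

/-- **`w(f) ≤ ncw(f)`** for a form of degree `d` over `ℂ`: an optimal ncABP for the symmetric tensor
of `f` (which exists, of width `wordTTRank`, by Nisan's theorem) is a cABP for `f`.
[cite: BlaserDorflerIkenmeyer2020, Thm 2 (arXiv; = CCC 2021 Thm 4.2), proof] -/
theorem abpWidth_le_ncAbpWidthPoly {d : ℕ} {f : MvPolynomial (Fin m) ℂ} (hf : f.IsHomogeneous d) :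
    abpWidth d f ≤ ncAbpWidthPoly d f := by
  have hne : {w | HasNcABPWidthLE w (symTensor d f)}.Nonempty :=
    ⟨wordTTRank (symTensor d f), (hasNcABPWidthLE_iff_wordTTRank_le _).2 le_rfl⟩
  have hmem : HasNcABPWidthLE (ncAbpWidthPoly d f) (symTensor d f) := Nat.sInf_mem hne
  exact abpWidth_le ⟨symTensor d f, isWordLift_symTensor hf, hmem⟩

/-- **`ncw(f) ≤ W̄R(f)`** for a form of degree `d ≥ 1` over `ℂ`: the flattening ranks of the
symmetric tensor are at most the border Waring rank, and Nisan's theorem converts the rank bound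
into an ncABP. [cite: BlaserDorflerIkenmeyer2020, Thm 2 (arXiv; = CCC 2021 Thm 4.2), proof] -/
theorem ncAbpWidthPoly_le_borderPolyWaringRank {d : ℕ} {f : MvPolynomial (Fin m) ℂ}
    (hf : f.IsHomogeneous d) (hd : 0 < d) : ncAbpWidthPoly d f ≤ borderPolyWaringRank d f := by
  have hne : {r | IsBorderWaringRankLE d r f}.Nonempty := exists_isBorderWaringRankLE_of_isHomogeneous hd hf
  have hr : IsBorderWaringRankLE d (borderPolyWaringRank d f) f := Nat.sInf_mem hne
  refine ncAbpWidth_le ((hasNcABPWidthLE_iff_wordTTRank_le _).2 (wordTTRank_le_iff.2 ?_))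
  intro a b h
  exact rank_wordFlattening_symTensor_le_of_isBorderWaringRankLE hr a b h

end Assembly

end BDI2020

/-- **BDI Thm. 4.2 (chain form `w(f) ≤ ncw(f) ≤ W̄R(f)`) — DISCHARGED.** With the statement file's
proved glue, `BDI2020_thm_4_2` and `BDI2020_thm_4_1` (`VW̄aring ⊆ VBP`) follow
(`BDI2020_thm_4_2_holds`, `BDI2020_thm_4_1_holds`). [cite: BlaserDorflerIkenmeyer2020, Thm 2 (arXiv; = CCC 2021 Thm 4.2)] -/
theorem BDI2020_thm_4_2_chain_holds : BDI2020_thm_4_2_chain :=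
  fun _ _ _ hf hd =>
    ⟨BDI2020.abpWidth_le_ncAbpWidthPoly hf, BDI2020.ncAbpWidthPoly_le_borderPolyWaringRank hf hd⟩

/-- **BDI Thm. 4.2 `w(f) ≤ W̄R(f)` — DISCHARGED.** [cite: BlaserDorflerIkenmeyer2020, Thm 2 (arXiv; = CCC 2021 Thm 4.2)] -/
theorem BDI2020_thm_4_2_holds : BDI2020_thm_4_2 :=
  BDI2020_thm_4_2_of_chain BDI2020_thm_4_2_chain_holds

/-- **BDI Thm. 4.1 `VW̄aring ⊆ VBP` — DISCHARGED.** [cite: BlaserDorflerIkenmeyer2020, Thm 1 (arXiv; = CCC 2021 Thm 4.1)] -/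
theorem BDI2020_thm_4_1_holds : BDI2020_thm_4_1 :=
  BDI2020_thm_4_1_of_thm_4_2 BDI2020_thm_4_2_holds

end Literature.Computability.AlgebraicComplexity

end
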